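import Mathlib
import Summits.QuantumFields.BalabanUV.Beta.CovariantPlateauBlocksPair
import Summits.QuantumFields.BalabanUV.Beta.AccretiveCombesThomas

/-!
# Beta / CovariantPlateauBlocksPerturbed — THE GENERAL-U MODEL INSTANCE OF E-I3, PART 5: the fine form may carry ANY Hermitian
# perturbation of relative size `p < μ₀` — NOTE-I3 §5.2 (s) at MODEL level («the a-terms Σ_j a(L^jη)^{d−2}|Q_j r_B|² are MASS-type …
# Δ″ is a bounded LOCAL operator with the small factor α₀ — its contribution to E is O(Mα₀)×(mass)»): for
# `A = μ₀·1 + D_Wᴴ D_W + P`, `Pᴴ = P`, `|Re z*Pz| ≤ p‖z‖²`, `p < μ₀`, the fine form is Hermitian, `Re`-coercive (hence invertible) and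
# Gram-dominated with `μ₀ + p`, so the one- and two-transport ENDs of parts 2∕4 hold VERBATIM with `μ₀ + p` in the energy constant
# (unit `b2b-balaban-beta-d4-p2`, GEN 6, MODEL crew; sequel of claims «E-I3-COV-MODEL»∕«E-I3-COV-PAIR», journal l.15376∕l.16069)

HONEST FRAMING: discharging `BetaPertH` makes Bałaban's UV stability UNCONDITIONAL — NOT the continuum limit, NOT the
Clay problem.  HONEST DEPENDENCY (verbatim): «continuum YM on T⁴ ⇐ BetaPertH ∧ nine spine estimates (0/9 proved);
BetaPertH ⇐ (D1) ∧ (D4) ∧ CAP+tail; G-an2-4 gates asym, D1 and NE2/3/4.»  THIS MODULE DISCHARGES NOTHING of `BetaPertH`,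
asserts NOTHING printed and cites nothing as a fact (ABSOLUTE RULE): [folklore] linear algebra about a MODEL; the perturbation `P` is
DATA (which `P` — the lower-scale a-terms `Σ_l a_l Q_lᴴQ_l`, the (3.138)-perturbation `Δ″`, curvature terms of the vector Laplacian — and
the size of `p` are NODE O.2's ∕ NOTE-A42's business); nothing of Bałaban's operators instantiated.  SHAPES located at [B9] =
`Balaban1985BackgroundPropagators` (3.16) p. 393, (3.132)–(3.138) pp. 422–423.  No class change on row D4 or G-B9-15 (width 0; D4
DISCHARGE NO DATE); NOT BetaPertH, NOT continuum, NOT Clay, NOT summit progress.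

CONTENT (kernel, 0 sorry).  §1 `pertForm μ₀ D P := gramForm μ₀ D + P` and its four engine hypotheses from `Pᴴ = P`, `|Re z*Pz| ≤ p·‖z‖²`,
`p < μ₀`: `pertForm_isHermitian`, **`re_form_pertForm_ge`** (`(μ₀ − p)‖z‖² ≤ Re z*Az`), `isUnit_pertForm` (d4-p3's `isUnit_of_reCoercive`),
`re_form_pertForm_nonneg`, **`re_form_pertForm_le`** (Gram domination with `μ₀ + p`).  §2 ENDs: **`coarse_coercive_plateau_blocks_pert`**
(one transport, owner's `coarse_coercive_cov`) and **`coarse_coercive_plateau_blocks_pair_pert`** (two transports, any monotone contour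
family, d4-p3's `coarse_coercive_cov₂`) — the constants of parts 2∕4 with `μ₀ + p` for `μ₀`.  §3 a MASS-TYPE perturbation is admissible:
`re_form_conjTranspose_mul_self` (`Re z*(KᴴK)z = ‖Kz‖² ≥ 0`) and **`abs_re_form_sum_gram_le`** (`P = Σ_l a_l K_lᴴK_l`, `a_l ≥ 0`,
`‖K_l z‖² ≤ c_l‖z‖²` ⟹ `|Re z*Pz| ≤ (Σ_l a_l c_l)‖z‖²` — the a-terms of the lower averaging constraints «by counting»).  §4 non-vacuity.
-/

namespace Summit.QuantumFields.BalabanUV.Beta.CovariantPlateauBlocksPerturbed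

open scoped BigOperators Matrix Matrix.Norms.L2Operator ComplexConjugate
open Finset
open Literature.MathematicalPhysics.QuantumFieldTheory.Balaban1983to89.B5Prop11Lower (nsq nsq_nonneg star_dotProduct_self)
open Literature.MathematicalPhysics.QuantumFieldTheory.Balaban1983to89.B7Prop1Explicit (Site disp)
open Summit.QuantumFields.BalabanUV.Beta.AccretiveCombesThomas (isUnit_of_reCoercive)
open Summit.QuantumFields.BalabanUV.Beta.AccretiveCombesThomasSandwich (sandwich)
open Summit.QuantumFields.BalabanUV.Beta.CoarseCoerciveTransport (covFamily)
open Summit.QuantumFields.BalabanUV.Beta.CoarseCoerciveCovariantEnergy (covDiff coarse_coercive_cov)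
open Summit.QuantumFields.BalabanUV.Beta.CoarseCoerciveTransportPair (coarse_coercive_cov₂)
open Summit.QuantumFields.BalabanUV.Beta.CoarseCoerciveBlock1D (gramForm gramForm_isHermitian re_form_gramForm)
open Summit.QuantumFields.BalabanUV.Beta.ThinLoopHolonomy (cpxHom)
open Summit.QuantumFields.BalabanUV.Beta.MonotoneLoopHolonomy (posWord)
open Summit.QuantumFields.BalabanUV.Beta.CovariantPlateauBlocks
open Summit.QuantumFields.BalabanUV.Beta.CovariantPlateauBlocksEnd
open Summit.QuantumFields.BalabanUV.Beta.CovariantPlateauBlocksPair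

noncomputable section

/-! ## §1 Perturbed Gram forms -/

section Pert

variable {ι X : Type*} [Fintype ι] [Fintype X] [DecidableEq X]

/-- THE PERTURBED FINE FORM `μ₀·1 + DᴴD + P` (MODEL of `G̃₀⁻¹ + Δ″` ∕ of the a-terms below the block scale). [cite: Balaban1985BackgroundPropagators, (3.138) p.423] -/
def pertForm (μ0 : ℝ) (D : Matrix ι X ℂ) (P : Matrix X X ℂ) : Matrix X X ℂ := gramForm μ0 D + P

/-- The quadratic form splits. [folklore] -/
theorem re_form_pertForm (μ0 : ℝ) (D : Matrix ι X ℂ) (P : Matrix X X ℂ) (z : X → ℂ) :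
    (star z ⬝ᵥ (pertForm μ0 D P *ᵥ z)).re = μ0 * nsq z + nsq (D *ᵥ z) + (star z ⬝ᵥ (P *ᵥ z)).re := by
  rw [pertForm, Matrix.add_mulVec, dotProduct_add, Complex.add_re, re_form_gramForm]

omit [Fintype X] in
/-- Hermitian for Hermitian `P`. [folklore] -/
theorem pertForm_isHermitian (μ0 : ℝ) (D : Matrix ι X ℂ) {P : Matrix X X ℂ} (hP : P.IsHermitian) :
    (pertForm μ0 D P).IsHermitian := by
  rw [pertForm]
  exact (gramForm_isHermitian μ0 D).add hP

/-- **COERCIVITY SURVIVES**: `(μ₀ − p)‖z‖² ≤ Re z*Az` when `|Re z*Pz| ≤ p‖z‖²`. [folklore] -/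
theorem re_form_pertForm_ge (μ0 : ℝ) (D : Matrix ι X ℂ) {P : Matrix X X ℂ} {p : ℝ}
    (hPp : ∀ z : X → ℂ, |(star z ⬝ᵥ (P *ᵥ z)).re| ≤ p * nsq z) (z : X → ℂ) :
    (μ0 - p) * nsq z ≤ (star z ⬝ᵥ (pertForm μ0 D P *ᵥ z)).re := by
  rw [re_form_pertForm]
  have h1 := (abs_le.mp (hPp z)).1
  have h2 := nsq_nonneg (D *ᵥ z)
  nlinarith

/-- … hence invertible for `p < μ₀` (d4-p3's `isUnit_of_reCoercive`). [folklore] -/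
theorem isUnit_pertForm {μ0 : ℝ} (D : Matrix ι X ℂ) {P : Matrix X X ℂ} {p : ℝ} (hp : p < μ0)
    (hPp : ∀ z : X → ℂ, |(star z ⬝ᵥ (P *ᵥ z)).re| ≤ p * nsq z) : IsUnit (pertForm μ0 D P) :=
  isUnit_of_reCoercive (sub_pos.mpr hp) (re_form_pertForm_ge μ0 D hPp)

/-- … and `Re`-positive. [folklore] -/
theorem re_form_pertForm_nonneg {μ0 : ℝ} (D : Matrix ι X ℂ) {P : Matrix X X ℂ} {p : ℝ} (hp : p < μ0)
    (hPp : ∀ z : X → ℂ, |(star z ⬝ᵥ (P *ᵥ z)).re| ≤ p * nsq z) (z : X → ℂ) :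
    0 ≤ (star z ⬝ᵥ (pertForm μ0 D P *ᵥ z)).re :=
  (mul_nonneg (sub_pos.mpr hp).le (nsq_nonneg z)).trans (re_form_pertForm_ge μ0 D hPp z)

/-- **GRAM DOMINATION WITH `μ₀ + p`**: `Re z*Az ≤ (μ₀ + p)‖z‖² + ‖Dz‖²` — the owner's hypothesis `hA` for the perturbed form.
[cite: Balaban1985BackgroundPropagators, (3.138) p.423] -/
theorem re_form_pertForm_le (μ0 : ℝ) (D : Matrix ι X ℂ) {P : Matrix X X ℂ} {p : ℝ}
    (hPp : ∀ z : X → ℂ, |(star z ⬝ᵥ (P *ᵥ z)).re| ≤ p * nsq z) (z : X → ℂ) :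
    (star z ⬝ᵥ (pertForm μ0 D P *ᵥ z)).re ≤ (μ0 + p) * nsq z + nsq (D *ᵥ z) := by
  rw [re_form_pertForm]
  have h1 := (abs_le.mp (hPp z)).2
  nlinarith

end Pert

/-! ## §2 The ENDs with a perturbed fine form -/

section Ends

variable {Y : Type*} [Fintype Y] [DecidableEq Y] {Cp : Type*} [Fintype Cp] [DecidableEq Cp] {ν n w : ℕ} [NeZero n]
variable (W : Bond Y ν n → Matrix Cp Cp ℝ) (hW : ∀ b, (W b)ᵀ * W b = 1)

/-- **E-I3 WITH A PERTURBED FINE FORM, ONE TRANSPORT (MODEL)**: `A = μ₀·1 + D_WᴴD_W + P`, `Pᴴ = P`, `|Re z*Pz| ≤ p‖z‖²`,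
`0 ≤ p < μ₀`; block average and bumps on the tree transports; every orthogonal `W` with in-block plaquettes within `α` of `1`:
`(((n−2w)/n)^ν)² / ((μ₀ + p)·n^ν + (1/w + H)(ν n^ν (1/w + H))) · ‖B‖² ≤ Re B*(Q̃_W A⁻¹ Q̃_Wᵀ)B`, `H = ν(n−1)α`.
[cite: Balaban1985BackgroundPropagators, (3.19) p.393, (3.138) p.423] -/
theorem coarse_coercive_plateau_blocks_pert [Nonempty Cp] (σ : Fin ν → Y → Y) (hw : 0 < w) (h2w : 2 * w < n) {μ0 p : ℝ}
    (hp0 : 0 ≤ p) (hp : p < μ0) {P : Matrix (BSite Y ν n × Cp) (BSite Y ν n × Cp) ℂ} (hP : P.IsHermitian)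
    (hPp : ∀ z, |(star z ⬝ᵥ (P *ᵥ z)).re| ≤ p * nsq z) {α : ℝ} (hα : 0 ≤ α)
    (hplaqW : ∀ (y : Y) (v : Off ν n) (κ μ : Fin ν) (hκ : (v κ : ℕ) + 1 < n) (hμ : (v μ : ℕ) + 1 < n), κ ≠ μ →
      ‖cpxHom (plaqW W y v κ μ hκ hμ) - 1‖ ≤ α) (B : Y × Cp → ℂ) :
    ((((n : ℝ) - 2 * w) / n) ^ ν) ^ 2 /
        ((μ0 + p) * (1 * (n : ℝ) ^ ν) +
          (1 / w + ν * ((n : ℝ) - 1) * α) * (ν * (n : ℝ) ^ ν * (1 / w + ν * ((n : ℝ) - 1) * α))) * nsq B ≤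
      (star B ⬝ᵥ (sandwich (pertForm μ0 (covDiff bsrc (btgt σ) W) P) (covFamily sB (Rfam W hW)) *ᵥ B)).re := by
  have hμp : 0 < μ0 + p := by linarith
  have hH0 : 0 ≤ ν * ((n : ℝ) - 1) * α := by
    have : (1 : ℝ) ≤ n := by exact_mod_cast Nat.pos_of_ne_zero (NeZero.ne n)
    have : 0 ≤ (n : ℝ) - 1 := by linarith
    positivity
  have hH := fun (b : Bond Y ν n) (hb : (b.1.2 b.2 : ℕ) + 1 < n) (y : Y) => hdef_le_of_plaqW W hW σ hα hplaqW hb y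
  have hδ0 : 0 < (((n : ℝ) - 2 * w) / n) ^ ν := by
    have hn : (0 : ℝ) < n := by exact_mod_cast Nat.pos_of_ne_zero (NeZero.ne n)
    have : (0 : ℝ) < (n : ℝ) - 2 * w := by
      have : (2 * w : ℝ) < n := by exact_mod_cast h2w
      linarith
    positivity
  have hθ0 : (0 : ℝ) ≤ 1 / w + ν * ((n : ℝ) - 1) * α := by positivity
  have hE : 0 < (μ0 + p) * (1 * (n : ℝ) ^ ν) +
      (1 / w + ν * ((n : ℝ) - 1) * α) * (ν * (n : ℝ) ^ ν * (1 / w + ν * ((n : ℝ) - 1) * α)) := by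
    have hn : (0 : ℝ) < n := by exact_mod_cast Nat.pos_of_ne_zero (NeZero.ne n)
    exact add_pos_of_pos_of_nonneg (mul_pos hμp (by positivity)) (by positivity)
  exact coarse_coercive_cov (pertForm μ0 (covDiff bsrc (btgt σ) W) P) (pertForm_isHermitian μ0 _ hP)
    (isUnit_pertForm _ hp hPp) (re_form_pertForm_nonneg _ hp hPp) bsrc (btgt σ) W hμp.le
    (re_form_pertForm_le μ0 _ hPp) (tB w) sB (fun y y' x h => tB_mul_sB_eq_zero y y' x h) (Rfam W hW)
    (fun _ x => Rtr_mul_transpose W hW x) hW hδ0 (mass_ge hw h2w.le) (hdef W hW σ) (hdef_nonneg W hW σ) (hhol_hdef W hW σ)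
    zero_le_one (sum_abs_tB_site_le hw) (sum_abs_tB_block_le hw) hθ0 (row_le W hW σ hw hH0 hH) (col_le W hW σ hw hH0 hH) hE B

/-- **E-I3 WITH A PERTURBED FINE FORM, TWO TRANSPORTS (MODEL)**: as above, with the block average on ANY monotone contour family
`ω` (recursive (3.55)-shape chains included) and `ε = (ν(n−1) choose 2)·α < 1` on the mixed loops:
`((1 − ε)((n−2w)/n)^ν)² / ((μ₀ + p)·n^ν + (1/w + H)(ν n^ν (1/w + H))) · ‖B‖² ≤ Re B*(Q̃_ω A⁻¹ Q̃_ωᵀ)B`.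
[cite: Balaban1985BackgroundPropagators, (3.55) p.401, (3.138) p.423] -/
theorem coarse_coercive_plateau_blocks_pair_pert [Nonempty Cp] (σ : Fin ν → Y → Y) (ω : Off ν n → List (Fin ν))
    (hω : ∀ v, disp (posWord (ω v)) = emb v) (hw : 0 < w) (h2w : 2 * w < n) {μ0 p : ℝ} (hp0 : 0 ≤ p) (hp : p < μ0)
    {P : Matrix (BSite Y ν n × Cp) (BSite Y ν n × Cp) ℂ} (hP : P.IsHermitian)
    (hPp : ∀ z, |(star z ⬝ᵥ (P *ᵥ z)).re| ≤ p * nsq z) {α : ℝ} (hα : 0 ≤ α)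
    (hε : ((ν * (n - 1)).choose 2 : ℕ) * α < 1)
    (hplaqW : ∀ (y : Y) (v : Off ν n) (κ μ : Fin ν) (hκ : (v κ : ℕ) + 1 < n) (hμ : (v μ : ℕ) + 1 < n), κ ≠ μ →
      ‖cpxHom (plaqW W y v κ μ hκ hμ) - 1‖ ≤ α) (B : Y × Cp → ℂ) :
    ((1 - ((ν * (n - 1)).choose 2 : ℕ) * α) * (((n : ℝ) - 2 * w) / n) ^ ν) ^ 2 /
        ((μ0 + p) * (1 * (n : ℝ) ^ ν) +
          (1 / w + ν * ((n : ℝ) - 1) * α) * (ν * (n : ℝ) ^ ν * (1 / w + ν * ((n : ℝ) - 1) * α))) * nsq B ≤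
      (star B ⬝ᵥ (sandwich (pertForm μ0 (covDiff bsrc (btgt σ) W) P) (covFamily sB (RgenFam W hW ω)) *ᵥ B)).re := by
  have hμp : 0 < μ0 + p := by linarith
  have hH0 : 0 ≤ ν * ((n : ℝ) - 1) * α := by
    have : (1 : ℝ) ≤ n := by exact_mod_cast Nat.pos_of_ne_zero (NeZero.ne n)
    have : 0 ≤ (n : ℝ) - 1 := by linarith
    positivity
  have hH := fun (b : Bond Y ν n) (hb : (b.1.2 b.2 : ℕ) + 1 < n) (y : Y) => hdef_le_of_plaqW W hW σ hα hplaqW hb y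
  have hδ0 : 0 < (((n : ℝ) - 2 * w) / n) ^ ν := by
    have hn : (0 : ℝ) < n := by exact_mod_cast Nat.pos_of_ne_zero (NeZero.ne n)
    have : (0 : ℝ) < (n : ℝ) - 2 * w := by
      have : (2 * w : ℝ) < n := by exact_mod_cast h2w
      linarith
    positivity
  have hθ0 : (0 : ℝ) ≤ 1 / w + ν * ((n : ℝ) - 1) * α := by positivity
  have hE : 0 < (μ0 + p) * (1 * (n : ℝ) ^ ν) +
      (1 / w + ν * ((n : ℝ) - 1) * α) * (ν * (n : ℝ) ^ ν * (1 / w + ν * ((n : ℝ) - 1) * α)) := by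
    have hn : (0 : ℝ) < n := by exact_mod_cast Nat.pos_of_ne_zero (NeZero.ne n)
    exact add_pos_of_pos_of_nonneg (mul_pos hμp (by positivity)) (by positivity)
  exact coarse_coercive_cov₂ (pertForm μ0 (covDiff bsrc (btgt σ) W) P) (pertForm_isHermitian μ0 _ hP)
    (isUnit_pertForm _ hp hPp) (re_form_pertForm_nonneg _ hp hPp) bsrc (btgt σ) W hμp.le
    (re_form_pertForm_le μ0 _ hPp) (tB w) sB (fun y y' x h => tB_mul_sB_eq_zero y y' x h) (tB_mul_sB_nonneg hw)
    (RgenFam W hW ω) (Rfam W hW) (fun _ x => Rtr_mul_transpose W hW x) hW hδ0 (mass_ge hw h2w.le) hε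
    (mixed_defect_le W hW ω hω hα hplaqW) (hdef W hW σ) (hdef_nonneg W hW σ) (hhol_hdef W hW σ) zero_le_one
    (sum_abs_tB_site_le hw) (sum_abs_tB_block_le hw) hθ0 (row_le W hW σ hw hH0 hH) (col_le W hW σ hw hH0 hH) hE B

end Ends

/-! ## §3 Mass-type perturbations are admissible: `P = Σ_l a_l K_lᴴ K_l` with bounded `K_l` -/

section Mass

variable {X : Type*} [Fintype X] [DecidableEq X]

omit [DecidableEq X] in
/-- `Re z*(KᴴK)z = ‖Kz‖²`. [folklore] -/
theorem re_form_conjTranspose_mul_self {Z : Type*} [Fintype Z] (K : Matrix Z X ℂ) (z : X → ℂ) :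
    (star z ⬝ᵥ ((Kᴴ * K) *ᵥ z)).re = nsq (K *ᵥ z) := by
  rw [← Matrix.mulVec_mulVec, Matrix.dotProduct_mulVec, Matrix.vecMul_conjTranspose, star_star, star_dotProduct_self,
    Complex.ofReal_re]

omit [DecidableEq X] in
/-- **THE a-TERMS «BY COUNTING»**: for `P = Σ_l a_l K_lᴴK_l` with `a_l ≥ 0` and `‖K_l z‖² ≤ c_l‖z‖²` (e.g. `K_l` = a covariant block
average at a LOWER scale — a contraction up to its volume factor), `|Re z*Pz| ≤ (Σ_l a_l c_l)·‖z‖²`; such `P` is Hermitian.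
[cite: Balaban1985BackgroundPropagators, (3.16) p.393] -/
theorem abs_re_form_sum_gram_le {L : Type*} [Fintype L] {Z : L → Type*} [∀ l, Fintype (Z l)] (a c : L → ℝ)
    (ha : ∀ l, 0 ≤ a l) (K : ∀ l, Matrix (Z l) X ℂ) (hK : ∀ l z, nsq (K l *ᵥ z) ≤ c l * nsq z) (z : X → ℂ) :
    |(star z ⬝ᵥ ((∑ l, ((a l : ℝ) : ℂ) • ((K l)ᴴ * K l)) *ᵥ z)).re| ≤ (∑ l, a l * c l) * nsq z := by
  have hexp : (star z ⬝ᵥ ((∑ l, ((a l : ℝ) : ℂ) • ((K l)ᴴ * K l)) *ᵥ z)).re = ∑ l, a l * nsq (K l *ᵥ z) := by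
    rw [Matrix.sum_mulVec, dotProduct_sum, Complex.re_sum]
    refine Finset.sum_congr rfl fun l _ => ?_
    rw [Matrix.smul_mulVec, dotProduct_smul, smul_eq_mul, Complex.re_ofReal_mul, re_form_conjTranspose_mul_self]
  rw [hexp, abs_of_nonneg (Finset.sum_nonneg fun l _ => mul_nonneg (ha l) (nsq_nonneg _)), Finset.sum_mul]
  exact Finset.sum_le_sum fun l _ => by
    have := hK l z
    have := ha l
    calc a l * nsq (K l *ᵥ z) ≤ a l * (c l * nsq z) := mul_le_mul_of_nonneg_left (hK l z) (ha l)
      _ = a l * c l * nsq z := by ring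

omit [Fintype X] [DecidableEq X] in
/-- Such a `P` is Hermitian. [folklore] -/
theorem isHermitian_sum_gram {L : Type*} [Fintype L] {Z : L → Type*} [∀ l, Fintype (Z l)] (a : L → ℝ)
    (K : ∀ l, Matrix (Z l) X ℂ) : (∑ l, ((a l : ℝ) : ℂ) • ((K l)ᴴ * K l)).IsHermitian := by
  rw [Matrix.isHermitian_iff_isSelfAdjoint]
  refine isSelfAdjoint_sum _ fun l _ => ?_
  rw [← Matrix.isHermitian_iff_isSelfAdjoint]
  have h : ((K l)ᴴ * K l).IsHermitian := Matrix.isHermitian_conjTranspose_mul_self (K l)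
  rw [Matrix.IsHermitian, Matrix.conjTranspose_smul, h.eq, Complex.star_def, Complex.conj_ofReal]

end Mass

/-! ## §4 Non-vacuity -/

/-- One block of side 3, `ν = 1`, `w = 1`, fibre `Unit`, flat `W`, `μ₀ = 1`, the ZERO perturbation with budget `p = 1/2`: the
perturbed END gives the explicit constant `(1/3)²/((1 + 1/2)·3 + 3) = 2/135`. [folklore] -/
example (B : Unit × Unit → ℂ) :
    (2 / 135 : ℝ) * nsq B ≤
      (star B ⬝ᵥ (sandwich (pertForm 1 (covDiff bsrc (btgt (fun (_ : Fin 1) (_ : Unit) => ()))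
          fun _ : Bond Unit 1 3 => (1 : Matrix Unit Unit ℝ)) 0)
        (covFamily (sB (Y := Unit) (ν := 1) (n := 3)) (Rfam (fun _ : Bond Unit 1 3 => (1 : Matrix Unit Unit ℝ)) flat_orth))
          *ᵥ B)).re := by
  have h := coarse_coercive_plateau_blocks_pert (Y := Unit) (Cp := Unit) (ν := 1) (n := 3) (w := 1) (μ0 := 1) (p := 1 / 2)
    (fun _ : Bond Unit 1 3 => (1 : Matrix Unit Unit ℝ)) flat_orth (fun (_ : Fin 1) (_ : Unit) => ()) Nat.one_pos (by norm_num)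
    (by norm_num) (by norm_num) (P := 0) Matrix.isHermitian_zero
    (fun z => by simp [nsq_nonneg]) (α := 0) le_rfl (fun y v κ μ hκ hμ _ => by simp [plaqW]) B
  convert h using 2
  norm_num

end

end Summit.QuantumFields.BalabanUV.Beta.CovariantPlateauBlocksPerturbed
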